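import Literature.MathematicalPhysics.QuantumLattice.LocalDynamics
import HarnessLib

/-!
# Torus interactions are local, torus Hamiltonians are Hermitian: discharges for `LocalDynamics`

Topic `MathematicalPhysics/QuantumLattice`; sibling proof file of
`Literature/MathematicalPhysics/QuantumLattice/LocalDynamics.lean`. No statement is introduced or
changed; this file **discharges the named facts**

* `rectTorusInteraction_isLocal` (`rectTorusInteraction_isLocal_holds`): the interaction induced
  on the rectangular torus `𝕋 = Π i, ℤ/(Ls i)ℤ` (periodic boundary conditions) by a Hermitian
  lattice interaction `Φ` on `ℤ^d` is *local* — its term at `Y ⊆ 𝕋` lies in `𝔄_Y` and is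
  Hermitian;
* `rectTorusHamiltonian_isHermitian` (`rectTorusHamiltonian_isHermitian_holds`): hence the torus
  Hamiltonian `H_𝕋 = Σ_{Y ⊆ 𝕋} (rectTorusInteraction Φ Ls) Y` is Hermitian.

Proof. The term of `rectTorusInteraction Φ Ls` at `Y` is the `finsum`, over the wrap
representatives `X ⊆ ℤ^d` (`IsWrapRepresentative Ls X`) with `proj X = Y`, of the wrapped terms
`wrapTerm Ls X (Φ X)` (`rectTorusInteraction_apply`, definitional). Each wrapped term is supported
on `proj X = Y` (`isSupportedOn_wrapTerm`) and Hermitian (`wrapTerm_conjTranspose` and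
`Φ X = (Φ X)ᴴ`), and both properties hold for `0` and are preserved by `+`, hence by `finsum`
(Mathlib `finsum_induction`; this also covers the documented junk value `0` of a `finsum` with
infinite support). The Hamiltonian is then Hermitian by `localHamiltonian_isHermitian`, exactly the
interim proof recorded in `LocalDynamics.lean`.

## References

* B. Nachtergaele, R. Sims, *Lieb–Robinson bounds and the exponential clustering theorem*,
  Comm. Math. Phys. **265** (2006) 119–130, §2 "Main Results", first paragraph (arXiv
  math-ph/0506030, p. 4): "An interaction for such a system is a map `Φ` from the set of subsets
  of `V` to `𝔄_V` such that `Φ(X) ∈ 𝔄_X` and `Φ(X) = Φ(X)^*` for all `X ⊂ V`. The Hamiltonian is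
  defined by `H = Σ_{X ⊂ V} Φ(X)`" — a finite sum of self-adjoint elements, hence self-adjoint.
* O. Bratteli, D. W. Robinson, *Operator Algebras and Quantum Statistical Mechanics 2* (2nd ed.,
  Springer 1997), §6.2.1, Definition of an interaction (`Φ(X) = Φ(X)* ∈ 𝔄_X`) and eq. (6.2.4)
  (`H_Φ(Λ) = Σ_{X ⊆ Λ} Φ(X)`).
* M. B. Hastings, *Lieb–Schultz–Mattis in higher dimensions*, Phys. Rev. B **69** (2004) 104431
  (periodic boundary conditions on rectangular tori `L₁ × ⋯ × L_d`).
-/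

open Matrix

namespace Literature.MathematicalPhysics.QuantumLattice

open Literature.Probability.LatticeModels

/-! ### Closure of `𝔄_Y` and of Hermitian matrices under `finsum` -/

/-- `𝔄_Y` is closed under `finsum`: a `finsum` (over any index sort) of observables supported on
`Y` is supported on `Y`; this includes the junk value `0` of an infinitely supported family.
Bratteli–Robinson II §6.2.1 (`𝔄_Y` is a subalgebra); Nachtergaele–Sims (2006) §2. [folklore] -/
theorem IsSupportedOn.finsum {Λ : Type*} [Fintype Λ] [DecidableEq Λ] {q : ℕ} {ι : Sort*}
    {A : ι → Op Λ q} {Y : Finset Λ} (hA : ∀ i, IsSupportedOn (A i) Y) :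
    IsSupportedOn (∑ᶠ i, A i) Y :=
  finsum_induction (fun B : Op Λ q => IsSupportedOn B Y) (IsSupportedOn.zero Y)
    (fun _ _ hB hC => hB.add hC) hA

/-- A `finsum` (over any index sort) of Hermitian matrices is Hermitian; this includes the junk
value `0` of an infinitely supported family. Nachtergaele–Sims (2006) §2 (sums of self-adjoint
terms). [folklore] -/
theorem isHermitian_finsum {n : Type*} {ι : Sort*} {A : ι → Matrix n n ℂ}
    (hA : ∀ i, (A i).IsHermitian) : (∑ᶠ i, A i).IsHermitian :=
  finsum_induction (fun B : Matrix n n ℂ => B.IsHermitian) isHermitian_zero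
    (fun _ _ hB hC => hB.add hC) hA

/-! ### The torus interaction: terms, supports, hermiticity -/

section Torus

variable {d q : ℕ}

/-- A wrapped Hermitian term is Hermitian: `(wrapTerm Ls X A)ᴴ = wrapTerm Ls X Aᴴ = wrapTerm Ls X A`
(`wrapTerm_conjTranspose`). Bratteli–Robinson II §6.2.1; Hastings (2004). [folklore] -/
theorem isHermitian_wrapTerm (Ls : Fin d → ℕ) (X : Finset (Site d))
    {A : Matrix (X → Fin q) (X → Fin q) ℂ} (hA : A.IsHermitian) :
    (wrapTerm Ls X A).IsHermitian := by
  rw [IsHermitian, ← wrapTerm_conjTranspose, hA.eq]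

/-- The term of the torus interaction at `Y ⊆ 𝕋` is the `finsum` of the wrapped terms
`wrapTerm Ls X (Φ X)` over the wrap representatives `X ⊆ ℤ^d` projecting onto `Y` (definitional
unfolding of `rectTorusInteraction`). Hastings, PRB 69 (2004) 104431. [cite: Hastings2004] -/
theorem rectTorusInteraction_apply (Φ : LatticeInteraction d q) (Ls : Fin d → ℕ)
    (Y : Finset (RectTorusSite Ls)) :
    rectTorusInteraction Φ Ls Y =
      ∑ᶠ (X : Finset (Site d)) (_ : IsWrapRepresentative Ls X ∧ X.image (RectTorus.proj Ls) = Y),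
        wrapTerm Ls X (Φ X) :=
  rfl

/-- The terms of the torus interaction induced by a Hermitian lattice interaction are Hermitian
(no finiteness of the torus needed). Nachtergaele–Sims (2006) §2 (`Φ(X) = Φ(X)^*`);
Bratteli–Robinson II §6.2.1. [folklore] -/
theorem rectTorusInteraction_isHermitian {Φ : LatticeInteraction d q} (h : Φ.IsHermitian)
    (Ls : Fin d → ℕ) (Y : Finset (RectTorusSite Ls)) :
    (rectTorusInteraction Φ Ls Y).IsHermitian := by
  rw [rectTorusInteraction_apply]
  exact isHermitian_finsum fun X => isHermitian_finsum fun _ => isHermitian_wrapTerm Ls X (h X)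

/-- The term of the torus interaction at `Y ⊆ 𝕋` lies in `𝔄_Y` (all sides `Ls i ≠ 0`, so that the
torus is a finite spin system). Nachtergaele–Sims (2006) §2 (`Φ(X) ∈ 𝔄_X`); Bratteli–Robinson II
§6.2.1. [folklore] -/
theorem isSupportedOn_rectTorusInteraction (Φ : LatticeInteraction d q) (Ls : Fin d → ℕ)
    [∀ i, NeZero (Ls i)] (Y : Finset (RectTorusSite Ls)) :
    IsSupportedOn (rectTorusInteraction Φ Ls Y) Y := by
  rw [rectTorusInteraction_apply]
  exact IsSupportedOn.finsum fun X => IsSupportedOn.finsum fun hX =>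
    hX.2 ▸ isSupportedOn_wrapTerm Ls X (Φ X)

/-- **Discharge** of the named fact `rectTorusInteraction_isLocal`: the torus interaction of a
Hermitian lattice interaction is local (every term supported on its region and Hermitian), i.e. an
interaction in the sense of Nachtergaele–Sims (2006) §2, first paragraph ("`Φ(X) ∈ 𝔄_X` and
`Φ(X) = Φ(X)^*` for all `X ⊂ V`"); Bratteli–Robinson II §6.2.1; Hastings (2004) for the periodic
wrapping. [cite: Hastings2004] -/
theorem rectTorusInteraction_isLocal_holds : rectTorusInteraction_isLocal (d := d) (q := q) :=
  fun h Ls _ Y => ⟨isSupportedOn_rectTorusInteraction _ Ls Y, rectTorusInteraction_isHermitian h Ls Y⟩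

/-- **Discharge** of the named fact `rectTorusHamiltonian_isHermitian`: the Hamiltonian
`H_𝕋 = Σ_{Y ⊆ 𝕋} (rectTorusInteraction Φ Ls) Y` of a Hermitian lattice interaction on the
rectangular torus with periodic boundary conditions is Hermitian — a finite sum of the Hermitian
terms of a local interaction (`localHamiltonian_isHermitian` with
`rectTorusInteraction_isLocal_holds`). Nachtergaele–Sims (2006) §2 (`H = Σ_{X ⊂ V} Φ(X)` with
`Φ(X) = Φ(X)^*`); Bratteli–Robinson II §6.2.1, eq. (6.2.4). [folklore] -/
theorem rectTorusHamiltonian_isHermitian_holds : rectTorusHamiltonian_isHermitian (d := d) (q := q) :=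
  fun h Ls _ => localHamiltonian_isHermitian (rectTorusInteraction_isLocal_holds h Ls) _

/-- Usable form of `rectTorusHamiltonian_isHermitian_holds`. Nachtergaele–Sims (2006) §2;
Bratteli–Robinson II §6.2.1. [folklore] -/
theorem rectTorusHamiltonian_isHermitian' {Φ : LatticeInteraction d q} (h : Φ.IsHermitian)
    (Ls : Fin d → ℕ) [∀ i, NeZero (Ls i)] : (rectTorusHamiltonian Φ Ls).IsHermitian :=
  rectTorusHamiltonian_isHermitian_holds h Ls

/-- The cubic torus Hamiltonian `torusHamiltonian Φ L` (`L ≠ 0`) of a Hermitian lattice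
interaction is Hermitian (the rectangular case with constant sides,
`torusHamiltonian_eq_rectTorusHamiltonian`). Nachtergaele–Sims (2006) §2. [folklore] -/
theorem torusHamiltonian_isHermitian {Φ : LatticeInteraction d q} (h : Φ.IsHermitian) (L : ℕ)
    [NeZero L] : (torusHamiltonian Φ L).IsHermitian :=
  rectTorusHamiltonian_isHermitian_holds h fun _ => L

end Torus

end Literature.MathematicalPhysics.QuantumLattice
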